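import Summits.CriticalPhenomena.PercolationContinuityZ3.Theorems.Transplant.PlanarSkeletonFrm1
import Mathlib.Combinatorics.Hall.Basic
import Mathlib.Combinatorics.Enumerative.DoubleCounting
import HarnessLib

/-!
# Φ2 at the interface level, I: up/down neighbours of a frames-only skeleton, one-type degree transport, and the COLUMN MATCHING by
# Hall's theorem

builds on p205010 (kernel theorem, internal audit signed; external expert review pending) — nothing in this file uses p205010; nothing
here is a claim about the open node `SamePDropOfSkeletonFrm₁`.
Lane `prim-bschramm`, seat `prim-bschramm-p4` gen 14 (PART C3 of `P4-GENERAL.md`, §36: Φ2 — subcritical cylinders at `p_c` — DERIVED for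
every ONE-TYPE `PlanarSkeletonFrm`, at graph level: no group, no central shift, no kernel criterion).  Helper file
(`--supports stmt-CriticalPhenomena-4575 --as helper`).

The graph–subgraph strict inequality `p_c(C_{ℓ+3}) < p_c(C_ℓ)` (sequel files, via gen 10's `SubStrict.Setup`) needs an exhaustion of the big
cylinder by finite regions each kit column lies entirely inside or outside of.  On a Cayley graph the columns are right cosets of `⟨s₀⟩`; on a
bare skeleton they are THREADS of a column matching, which this file produces:
* `nbrsAt δ w` (neighbours one skeleton step `δ` away), `upNbrs`/`downNbrs` (`δ = ±e₀`), non-empty by (ι); FRAME TRANSPORT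
  `card_nbrsAt_eq_of_frame`, hence for a ONE-TYPE skeleton the up-degree `d⁺` and the down-degree `d⁻` are CONSTANT (`card_nbrsAt_eq`);
* the slab `slab t ℓ = {|φ₀ − φ₀ t| ≤ ℓ+2, |φ₁ − φ₁ t| ≤ ℓ+3}` of the big cylinder `C_{ℓ+3}(t)`, the matching domain `dom` (slab minus its floor);
* **`ColData Φ t ℓ`** = an injective map `g` on `dom` with `g w` a down-neighbour of `w` (a matching of every slab level INTO the level below);
* **`nonempty_colData`**: one type and `d⁺ ≤ d⁻` ⟹ `ColData` exists — Hall's condition by double counting (`|s|·d⁻ = #pairs ≤ |N(s)|·d⁺`)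
  and Mathlib's infinite Hall theorem `Finset.all_card_le_biUnion_card_iff_exists_injective`.  (The case `d⁺ ≥ d⁻` is the same statement
  for the reflected skeleton `Φ.reflect`, file V.)
[cite: AizenmanGrimmett1991, Thm 1 (essential enhancements)] [cite: KozmaNitzan2024, §4 p. 15 (boxes and their translates)]
-/

noncomputable section

namespace Summit.CriticalPhenomena.PercolationContinuityZ3.Theorems.Transplant

namespace PlanarSkeletonFrm

open SimpleGraph Literature.Probability.LatticeModels
open scoped Classical

variable {V : Type} {G : SimpleGraph V} [G.LocallyFinite] (Φ : PlanarSkeletonFrm G)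

/-! ## §1 Neighbours at a skeleton step -/

/-- The neighbours of `w` exactly one skeleton step `δ` away: `w' ~ w` with `φ w' = φ w + δ`. [cite: KozmaNitzan2024, §4 p. 15] -/
def nbrsAt (δ : Site 2) (w : V) : Finset V := (G.neighborFinset w).filter fun w' => Φ.φ w' = Φ.φ w + δ

/-- Membership in `nbrsAt`. [folklore] -/
theorem mem_nbrsAt {δ : Site 2} {w w' : V} : w' ∈ Φ.nbrsAt δ w ↔ G.Adj w w' ∧ Φ.φ w' = Φ.φ w + δ := by
  rw [nbrsAt, Finset.mem_filter, mem_neighborFinset]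

/-- The UP-neighbours (`φ ↦ φ + e₀`). [cite: KozmaNitzan2024, §4 p. 15] -/
def upNbrs (w : V) : Finset V := Φ.nbrsAt (Pi.single 0 1) w

/-- The DOWN-neighbours (`φ ↦ φ − e₀`). [cite: KozmaNitzan2024, §4 p. 15] -/
def downNbrs (w : V) : Finset V := Φ.nbrsAt (Pi.single 0 (-1)) w

/-- Membership in `upNbrs`. [folklore] -/
theorem mem_upNbrs {w w' : V} : w' ∈ Φ.upNbrs w ↔ G.Adj w w' ∧ Φ.φ w' = Φ.φ w + Pi.single 0 1 := Φ.mem_nbrsAt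

/-- Membership in `downNbrs`. [folklore] -/
theorem mem_downNbrs {w w' : V} : w' ∈ Φ.downNbrs w ↔ G.Adj w w' ∧ Φ.φ w' = Φ.φ w + Pi.single 0 (-1) := Φ.mem_nbrsAt

/-- Coordinates of an up-neighbour. [folklore] -/
theorem φ_of_mem_upNbrs {w w' : V} (h : w' ∈ Φ.upNbrs w) : Φ.φ w' 0 = Φ.φ w 0 + 1 ∧ Φ.φ w' 1 = Φ.φ w 1 := by
  have e := (Φ.mem_upNbrs.1 h).2
  refine ⟨by rw [e, Pi.add_apply, Pi.single_eq_same], by rw [e, Pi.add_apply, Pi.single_eq_of_ne (by decide), add_zero]⟩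

/-- Coordinates of a down-neighbour. [folklore] -/
theorem φ_of_mem_downNbrs {w w' : V} (h : w' ∈ Φ.downNbrs w) : Φ.φ w' 0 = Φ.φ w 0 - 1 ∧ Φ.φ w' 1 = Φ.φ w 1 := by
  have e := (Φ.mem_downNbrs.1 h).2
  refine ⟨by rw [e, Pi.add_apply, Pi.single_eq_same]; ring,
    by rw [e, Pi.add_apply, Pi.single_eq_of_ne (by decide), add_zero]⟩

/-- A vertex with the coordinates of an up-neighbour and adjacent is an up-neighbour. [folklore] -/
theorem mem_upNbrs_of_φ {w w' : V} (hadj : G.Adj w w') (h0 : Φ.φ w' 0 = Φ.φ w 0 + 1) (h1 : Φ.φ w' 1 = Φ.φ w 1) : w' ∈ Φ.upNbrs w := by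
  refine Φ.mem_upNbrs.2 ⟨hadj, ?_⟩
  ext i
  match i with
  | 0 => rw [Pi.add_apply, Pi.single_eq_same, h0]
  | 1 => rw [Pi.add_apply, Pi.single_eq_of_ne (by decide), add_zero, h1]

/-- A vertex with the coordinates of a down-neighbour and adjacent is a down-neighbour. [folklore] -/
theorem mem_downNbrs_of_φ {w w' : V} (hadj : G.Adj w w') (h0 : Φ.φ w' 0 = Φ.φ w 0 - 1) (h1 : Φ.φ w' 1 = Φ.φ w 1) :
    w' ∈ Φ.downNbrs w := by
  refine Φ.mem_downNbrs.2 ⟨hadj, ?_⟩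
  ext i
  match i with
  | 0 => rw [Pi.add_apply, Pi.single_eq_same, h0]; ring
  | 1 => rw [Pi.add_apply, Pi.single_eq_of_ne (by decide), add_zero, h1]

/-- `w'` is below `w` iff `w` is above `w'`. [folklore] -/
theorem mem_downNbrs_iff_mem_upNbrs {w w' : V} : w' ∈ Φ.downNbrs w ↔ w ∈ Φ.upNbrs w' := by
  constructor
  · intro h
    have hc := Φ.φ_of_mem_downNbrs h
    exact Φ.mem_upNbrs_of_φ (Φ.mem_downNbrs.1 h).1.symm (by omega) hc.2.symm
  · intro h
    have hc := Φ.φ_of_mem_upNbrs h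
    exact Φ.mem_downNbrs_of_φ (Φ.mem_upNbrs.1 h).1.symm (by omega) hc.2.symm

/-- (ι) ⟹ every vertex has an up-neighbour. [cite: KozmaNitzan2024, §4 p. 26 ((29))] -/
theorem upNbrs_nonempty (w : V) : (Φ.upNbrs w).Nonempty := by
  obtain ⟨w', hadj, hφ⟩ := Φ.step w 0 1
  exact ⟨w', Φ.mem_upNbrs.2 ⟨hadj, by rw [hφ, Units.val_one]⟩⟩

/-- (ι) ⟹ every vertex has a down-neighbour. [cite: KozmaNitzan2024, §4 p. 26 ((29))] -/
theorem downNbrs_nonempty (w : V) : (Φ.downNbrs w).Nonempty := by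
  obtain ⟨w', hadj, hφ⟩ := Φ.step w 0 (-1)
  exact ⟨w', Φ.mem_downNbrs.2 ⟨hadj, by rw [hφ, Units.val_neg, Units.val_one]⟩⟩

/-! ## §2 Frame transport of degrees; one type ⟹ constant up/down degrees -/

/-- **Frame transport**: a skeleton-translating automorphism with `α t = w` carries `nbrsAt δ t` onto `nbrsAt δ w`.
[cite: KozmaNitzan2024, §4 p. 15 (boxes and their translates)] -/
theorem nbrsAt_map_frame (δ : Site 2) {t w : V} (α : G ≃g G) (hαt : α t = w) (hα : ∀ u, Φ.φ (α u) = Φ.φ u + (Φ.φ w - Φ.φ t)) :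
    (Φ.nbrsAt δ t).map α.toEquiv.toEmbedding = Φ.nbrsAt δ w := by
  ext v
  rw [Finset.mem_map, Φ.mem_nbrsAt]
  constructor
  · rintro ⟨u, hu, rfl⟩
    rw [Φ.mem_nbrsAt] at hu
    refine ⟨?_, ?_⟩
    · have h := α.map_adj_iff.2 hu.1
      rwa [hαt] at h
    · show Φ.φ (α u) = Φ.φ w + δ
      rw [hα u, hu.2]; abel
  · rintro ⟨hadj, hφ⟩
    refine ⟨α.symm v, Φ.mem_nbrsAt.2 ⟨?_, ?_⟩, by simp⟩
    · have h := α.symm.map_adj_iff.2 hadj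
      rwa [← hαt, RelIso.symm_apply_apply] at h
    · have h := hα (α.symm v)
      rw [RelIso.apply_symm_apply] at h
      have : Φ.φ (α.symm v) = Φ.φ v - (Φ.φ w - Φ.φ t) := by rw [h]; abel
      rw [this, hφ]; abel

/-- Frame transport preserves the number of `δ`-neighbours. [folklore] -/
theorem card_nbrsAt_eq_of_frame (δ : Site 2) {t w : V} (α : G ≃g G) (hαt : α t = w)
    (hα : ∀ u, Φ.φ (α u) = Φ.φ u + (Φ.φ w - Φ.φ t)) : (Φ.nbrsAt δ w).card = (Φ.nbrsAt δ t).card := by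
  rw [← Φ.nbrsAt_map_frame δ α hαt hα, Finset.card_map]

/-- **One type ⟹ the `δ`-degree is constant** (every vertex is a frame image of the base vertex). [cite: KozmaNitzan2024, §4 p. 16 (Lemma 8)] -/
theorem card_nbrsAt_eq {t : V} (h1 : Φ.types = {t}) (δ : Site 2) (w : V) : (Φ.nbrsAt δ w).card = (Φ.nbrsAt δ t).card := by
  obtain ⟨t', ht', α, hαt, hα⟩ := Φ.frame w
  rw [h1, Finset.mem_singleton] at ht'
  subst ht'
  exact Φ.card_nbrsAt_eq_of_frame δ α hαt hα

/-- One type: constant up-degree. [folklore] -/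
theorem card_upNbrs_eq {t : V} (h1 : Φ.types = {t}) (w : V) : (Φ.upNbrs w).card = (Φ.upNbrs t).card := Φ.card_nbrsAt_eq h1 _ w

/-- One type: constant down-degree. [folklore] -/
theorem card_downNbrs_eq {t : V} (h1 : Φ.types = {t}) (w : V) : (Φ.downNbrs w).card = (Φ.downNbrs t).card :=
  Φ.card_nbrsAt_eq h1 _ w

/-! ## §3 The slab, the matching domain, column data -/

/-- **The slab** of the construction at base `t`, level `ℓ`: `|φ₀ − φ₀(t)| ≤ ℓ+2` and `|φ₁ − φ₁(t)| ≤ ℓ+3` (inside the big cylinder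
`C_{ℓ+3}(t)`; the kit columns live here). [cite: KozmaNitzan2024, §4 p. 15 (boxes)] -/
def slab (t : V) (ℓ : ℕ) : Set V := {w | |Φ.φ w 0 - Φ.φ t 0| ≤ (ℓ : ℤ) + 2 ∧ |Φ.φ w 1 - Φ.φ t 1| ≤ (ℓ : ℤ) + 3}

/-- Membership in the slab. [folklore] -/
theorem mem_slab {t : V} {ℓ : ℕ} {w : V} :
    w ∈ Φ.slab t ℓ ↔ |Φ.φ w 0 - Φ.φ t 0| ≤ (ℓ : ℤ) + 2 ∧ |Φ.φ w 1 - Φ.φ t 1| ≤ (ℓ : ℤ) + 3 := Iff.rfl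

/-- **The matching domain**: slab vertices strictly above the floor `φ₀ − φ₀(t) = −(ℓ+2)`. [folklore] -/
def dom (t : V) (ℓ : ℕ) : Set V := {w | w ∈ Φ.slab t ℓ ∧ -((ℓ : ℤ) + 2) < Φ.φ w 0 - Φ.φ t 0}

/-- Membership in the matching domain. [folklore] -/
theorem mem_dom {t : V} {ℓ : ℕ} {w : V} : w ∈ Φ.dom t ℓ ↔ w ∈ Φ.slab t ℓ ∧ -((ℓ : ℤ) + 2) < Φ.φ w 0 - Φ.φ t 0 := Iff.rfl

/-- A down-neighbour of a domain vertex lies in the slab. [folklore] -/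
theorem downNbrs_mem_slab {t : V} {ℓ : ℕ} {w w' : V} (hw : w ∈ Φ.dom t ℓ) (hw' : w' ∈ Φ.downNbrs w) : w' ∈ Φ.slab t ℓ := by
  have hc := Φ.φ_of_mem_downNbrs hw'
  obtain ⟨⟨h0, h1⟩, hlo⟩ := hw
  rw [abs_le] at h0 h1
  refine ⟨abs_le.2 ⟨?_, ?_⟩, abs_le.2 ⟨?_, ?_⟩⟩ <;> omega

/-- An up-neighbour of a slab vertex below the ceiling lies in the domain. [folklore] -/
theorem upNbrs_mem_dom {t : V} {ℓ : ℕ} {w w' : V} (hw : w ∈ Φ.slab t ℓ) (hlt : Φ.φ w 0 - Φ.φ t 0 < (ℓ : ℤ) + 2)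
    (hw' : w' ∈ Φ.upNbrs w) : w' ∈ Φ.dom t ℓ := by
  have hc := Φ.φ_of_mem_upNbrs hw'
  obtain ⟨h0, h1⟩ := hw
  rw [abs_le] at h0 h1
  refine ⟨⟨abs_le.2 ⟨?_, ?_⟩, abs_le.2 ⟨?_, ?_⟩⟩, ?_⟩ <;> omega

/-- **COLUMN DATA** at base `t`, level `ℓ`: an injective map on the matching domain sending every vertex to one of its down-neighbours
(a matching of each slab level INTO the level below).  Supplied by Hall's theorem for one-type skeletons with `d⁺ ≤ d⁻`
(`nonempty_colData`). [cite: AizenmanGrimmett1991, Thm 1 (essential enhancements: the local geometry)] -/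
structure ColData (t : V) (ℓ : ℕ) where
  /-- the down-matching -/
  g : V → V
  /-- `g w` is a down-neighbour of `w` on the domain -/
  g_mem : ∀ w ∈ Φ.dom t ℓ, g w ∈ Φ.downNbrs w
  /-- `g` is injective on the domain -/
  g_inj : Set.InjOn g (Φ.dom t ℓ)

/-! ## §4 Hall's condition from constant degrees; existence of column data -/

/-- **Hall's condition** for matching the domain into down-neighbours, from one type and `d⁺ ≤ d⁻`: for a finite set `s` of domain
vertices, `|s|·d⁻ = #{(w, v) : v ∈ downNbrs w} ≤ |N(s)|·d⁺ ≤ |N(s)|·d⁻`. [folklore] -/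
theorem hall_condition {t : V} (h1 : Φ.types = {t}) (hdeg : (Φ.upNbrs t).card ≤ (Φ.downNbrs t).card) (ℓ : ℕ)
    (s : Finset (Φ.dom t ℓ)) : s.card ≤ (s.biUnion fun w => Φ.downNbrs w.1).card := by
  set N := s.biUnion fun w => Φ.downNbrs w.1 with hN
  set r : Φ.dom t ℓ → V → Prop := fun w v => v ∈ Φ.downNbrs w.1 with hr
  have hdc := Finset.sum_card_bipartiteAbove_eq_sum_card_bipartiteBelow r (s := s) (t := N)
  -- left side: every term is `d⁻`
  have hL : ∑ a ∈ s, (Finset.bipartiteAbove r N a).card = s.card * (Φ.downNbrs t).card := by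
    rw [Finset.sum_const_nat]
    intro w hw
    have e : Finset.bipartiteAbove r N w = Φ.downNbrs w.1 := by
      ext v
      rw [Finset.mem_bipartiteAbove]
      constructor
      · exact fun h => h.2
      · exact fun h => ⟨Finset.mem_biUnion.2 ⟨w, hw, h⟩, h⟩
    rw [e, Φ.card_downNbrs_eq h1]
  -- right side: every term is `≤ d⁺`
  have hR : ∑ b ∈ N, (Finset.bipartiteBelow r s b).card ≤ N.card * (Φ.upNbrs t).card := by
    rw [← smul_eq_mul, ← Finset.sum_const]
    refine Finset.sum_le_sum fun v _ => ?_
    rw [← Φ.card_upNbrs_eq h1 v]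
    refine Finset.card_le_card_of_injOn (fun w => w.1) (fun w hw => ?_) ?_
    · rw [Finset.mem_coe, Finset.mem_bipartiteBelow] at hw
      exact Φ.mem_downNbrs_iff_mem_upNbrs.1 hw.2
    · exact fun a _ b _ h => Subtype.ext h
  have hpos : 0 < (Φ.downNbrs t).card := Finset.card_pos.2 (Φ.downNbrs_nonempty t)
  have key : s.card * (Φ.downNbrs t).card ≤ N.card * (Φ.downNbrs t).card :=
    calc s.card * (Φ.downNbrs t).card = ∑ b ∈ N, (Finset.bipartiteBelow r s b).card := by rw [← hL, hdc]
      _ ≤ N.card * (Φ.upNbrs t).card := hR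
      _ ≤ N.card * (Φ.downNbrs t).card := Nat.mul_le_mul_left _ hdeg
  exact Nat.le_of_mul_le_mul_right key hpos

/-- **EXISTENCE OF COLUMN DATA** (one type, `d⁺ ≤ d⁻`): Hall's marriage theorem for the locally finite infinite family
`w ↦ downNbrs w` over the matching domain. [folklore] -/
theorem nonempty_colData {t : V} (h1 : Φ.types = {t}) (hdeg : (Φ.upNbrs t).card ≤ (Φ.downNbrs t).card) (ℓ : ℕ) :
    Nonempty (Φ.ColData t ℓ) := by
  obtain ⟨f, hf, hfm⟩ := (Finset.all_card_le_biUnion_card_iff_exists_injective fun w : Φ.dom t ℓ => Φ.downNbrs w.1).1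
    (Φ.hall_condition h1 hdeg ℓ)
  refine ⟨⟨fun w => if h : w ∈ Φ.dom t ℓ then f ⟨w, h⟩ else w, fun w hw => ?_, fun a ha b hb hab => ?_⟩⟩
  · simp only [dif_pos hw]; exact hfm ⟨w, hw⟩
  · simp only [dif_pos ha, dif_pos hb] at hab
    exact congrArg Subtype.val (hf hab)

namespace ColData

variable {Φ} {t : V} {ℓ : ℕ} (C : Φ.ColData t ℓ)

/-- `g w` is adjacent to `w`. [folklore] -/
theorem adj_g {w : V} (hw : w ∈ Φ.dom t ℓ) : G.Adj w (C.g w) := (Φ.mem_downNbrs.1 (C.g_mem w hw)).1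

/-- Coordinates of `g w`. [folklore] -/
theorem φ_g {w : V} (hw : w ∈ Φ.dom t ℓ) : Φ.φ (C.g w) 0 = Φ.φ w 0 - 1 ∧ Φ.φ (C.g w) 1 = Φ.φ w 1 := Φ.φ_of_mem_downNbrs (C.g_mem w hw)

/-- `g w` lies in the slab. [folklore] -/
theorem g_mem_slab {w : V} (hw : w ∈ Φ.dom t ℓ) : C.g w ∈ Φ.slab t ℓ := Φ.downNbrs_mem_slab hw (C.g_mem w hw)

/-- `w` is an up-neighbour of `g w`. [folklore] -/
theorem mem_upNbrs_g {w : V} (hw : w ∈ Φ.dom t ℓ) : w ∈ Φ.upNbrs (C.g w) := Φ.mem_downNbrs_iff_mem_upNbrs.1 (C.g_mem w hw)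

end ColData

end PlanarSkeletonFrm

end Summit.CriticalPhenomena.PercolationContinuityZ3.Theorems.Transplant

end
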